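import Mathlib
import HarnessLib
import Summits.FinalStateConjecture.Statement
import Literature.Geometry.Lorentzian.LandauLifshitzPseudotensor
import Literature.Geometry.Lorentzian.CausalityProofs

/-!
# Route EIHFluxBalance — `InertialRecession`, the dispersive case `N = 0`

Helper file for the crux `stmt-FinalStateConjecture-10166`
(`Summit.FinalStateConjecture.FinalStateConjecture.Theses.EIHFluxBalance.InertialRecession`).

`InertialRecession` says: a maximal vacuum Cauchy development which is asymptotic, in one lab
chart `Φ : U → M`, to a modulated `N`-centre Kerr–Schild ansatz carries a `C²`
`FinalStateDecomposition` of its self-determined exterior with exhaustive charts. Any proof splits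
on the number `N` of holes. This file settles the case **`N = 0` (dispersal)**, which is pure
bookkeeping: the ansatz is the Minkowski background on `U`, the lab chart `Φ` itself is the flat
(radiation-zone) chart of a decomposition with no hole, started one unit of lab time later
(`τ₀ + 1`, so that the covering clause of the structure is an instance of the hypothesis'
exhaustion clause, which is only asserted for lab times `> τ₀`), on the region
`O' = J⁺(ι X) ∩ I⁻(Φ({x⁰ > τ₀ + 1}))`, which is contained in the hypothesis' region `O` by
monotonicity of `I⁻`.

The one geometric input is the folklore causal lemma `subset_chronologicalFuture_of_isOpen`:
an open set of a spacetime (manifold without boundary) lies in its own chronological future and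
past — from the local cone lemma `exists_nhds_forall_isFutureTimelikeCurveOn_from` of
`Literature.Geometry.Lorentzian.CausalityProofs` (O'Neill 1983, Ch. 14, Lemma 14.2–14.3).

Main result: `inertialRecession_noHoles` — the hypothesis of `InertialRecession` with `N = 0`
implies its conclusion (for every vacuum Cauchy development; maximality and admissibility of the
data are not used in this case).

Revision 2026-08-16: the summit re-typing of 2026-08-16 (semantic-vacuity audit, §2.1 (B))
strengthened `Summit.FinalStateConjecture.HasExhaustiveCharts` by the honest-radii clause
`∀ i, Tendsto (R i) atTop atTop ∧ ∀ τ, max (r₊(Mᵢ, aᵢ)) 0 + 1 ≤ R i τ`; with no hole it is vacuous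
(`fun i ↦ i.elim0`), and the proof below supplies it. Statement unchanged.
-/

noncomputable section

set_option linter.dupNamespace false

open scoped Manifold ContDiff Topology BigOperators ENNReal
open Filter Set TopologicalSpace Literature.Geometry.Lorentzian

namespace Summit.FinalStateConjecture.FinalStateConjecture.Theorems

/-! ### An open set lies in its own chronological future and past -/

section Causal

variable {E : Type*} [NormedAddCommGroup E] [NormedSpace ℝ E] {H : Type*} [TopologicalSpace H]
  {I : ModelWithCorners ℝ E H} {n : ℕ∞ω} {M : Type*} [TopologicalSpace M] [ChartedSpace H M]
  [IsManifold I ∞ M]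

/-- **An open set lies in its own chronological future** (manifold without boundary): for
`p ∈ W`, `W` open, the local cone lemma gives a future timelike segment `γ : [0, 1] → M` ending at
`p`; by continuity `γ s ∈ W` for `s < 1` close to `1`, and `γ|[s, 1]` is a future timelike curve
from `γ s ∈ W` to `p`. O'Neill 1983, Ch. 14, Lemma 14.2 (5)–14.3 (p. 403). [folklore] -/
theorem subset_chronologicalFuture_of_isOpen [BoundarylessManifold I M]
    (g : LorentzianMetric I n M) (τ : TimeOrientation g) {W : Set M} (hW : IsOpen W) :
    W ⊆ g.chronologicalFuture τ W := by
  intro p hp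
  obtain ⟨q', V, hVp, hV⟩ := g.exists_nhds_forall_isFutureTimelikeCurveOn_from τ
    (BoundarylessManifold.isInteriorPoint (I := I) (x := p))
  obtain ⟨γ, hγ, -, hγ1⟩ := hV p (mem_of_mem_nhds hVp)
  have hc : ContinuousAt γ 1 := (hγ 1 ⟨zero_le_one, le_rfl⟩).1.continuousAt
  have hW1 : W ∈ 𝓝 (γ 1) := hW.mem_nhds (by rw [hγ1]; exact hp)
  have h1 : ∀ᶠ s in 𝓝[<] (1 : ℝ), γ s ∈ W :=
    mem_nhdsWithin_of_mem_nhds (hc.preimage_mem_nhds hW1)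
  have h2 : ∀ᶠ s in 𝓝[<] (1 : ℝ), s ∈ Ico (0 : ℝ) 1 := Ico_mem_nhdsLT one_pos
  obtain ⟨s, hsW, hs0, hs1⟩ := (h1.and h2).exists
  exact ⟨γ s, hsW, γ, s, 1, hs1, hγ.mono (Icc_subset_Icc hs0 le_rfl), rfl, hγ1⟩

/-- **An open set lies in its own chronological past** (time dual of
`subset_chronologicalFuture_of_isOpen`). O'Neill 1983, Ch. 14, p. 403. [folklore] -/
theorem subset_chronologicalPast_of_isOpen [BoundarylessManifold I M]
    (g : LorentzianMetric I n M) (τ : TimeOrientation g) {W : Set M} (hW : IsOpen W) :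
    W ⊆ g.chronologicalPast τ W :=
  subset_chronologicalFuture_of_isOpen g τ.reverse hW

end Causal

/-! ### Bookkeeping: the bilinear-form field of a literal reference background -/

/-- Congruence of `Spacetime.deviationCk` in the reference bilinear-form field of a literal
`ModelBackground` (the other fields fixed); used to replace the empty `N = 0` Kerr–Schild sum
`η + ∑_{i : Fin 0} (…)` by `η`. [folklore] -/
theorem deviationCk_mk_congr (𝓢 : Spacetime 4) (U : Opens E4)
    {b b' : E4 → E4 →L[ℝ] E4 →L[ℝ] ℝ} (hb : b = b') (tf rf : E4 → ℝ) (Ψ : U → 𝓢.carrier)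
    (k : ℕ) (τ : ℝ) :
    𝓢.deviationCk ⟨U, b, tf, rf⟩ Ψ k τ = 𝓢.deviationCk ⟨U, b', tf, rf⟩ Ψ k τ := by
  subst hb
  rfl

/-! ### The dispersive case of `InertialRecession` -/

/-- **`InertialRecession`, case `N = 0` (dispersal).** If a vacuum Cauchy development is
asymptotic, in a lab chart `Φ : U → M` defined on (a neighbourhood of) the late half-space
`{x⁰ > τ₀}`, to the modulated multi-Kerr–Schild ansatz WITH NO HOLE — i.e. `Φ^* g → η` in `C³`
on the lab slabs, `O = J⁺(ι X) ∩ I⁻(Φ{x⁰ > τ₀})`, and `O` is exhausted by the lab slabs — then it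
carries a `C²` final state decomposition `d` with `d.N = 0`, sub-extremal (vacuously),
`O' = J⁺(ι X) ∩ I⁻(d.charted)` and `HasExhaustiveCharts d`. Construction: `d.τ₀ = τ₀ + 1`, flat
domain `U`, flat chart `Φ`, `O' = J⁺(ι X) ∩ I⁻(Φ{x⁰ > τ₀ + 1}) ⊆ O`; `Φ{x⁰ > τ₀ + 1} ⊆ O'` because
an open set lies in its own chronological past (`subset_chronologicalPast_of_isOpen`); the
covering and exhaustion clauses are the hypothesis' exhaustion clause at lab times `τ₀ + 1` and
`τ₁ > τ₀ + 1`, transported along `O' ⊆ O` and monotonicity of `J⁻`. The hypothesis is literally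
that of `Theses.EIHFluxBalance.InertialRecession` with `N` specialised to `0` (so a prover of the
crux can `obtain ⟨N, h⟩` and dispatch `N = 0` here); maximality and admissibility are not needed. -/
theorem inertialRecession_noHoles
    (X : Type) [TopologicalSpace X] [ChartedSpace E3 X]
    [IsManifold (𝓡 3) ((⊤ : ℕ∞) : WithTop ℕ∞) X] [ConnectedSpace X]
    (D : InitialDataSet (𝓡 3) X) (𝒟 : VacuumCauchyDevelopment D)
    (h : ∃ (M a rin : Fin 0 → ℝ) (Λ : Fin 0 → ℝ → lorentzGroup) (ξ : Fin 0 → ℝ → E3) (γ κ τ₀ : ℝ) (U : Opens E4) (Φ : U → 𝒟.carrier) (O : Set 𝒟.carrier), (∀ i, Kerr.IsSubextremal (M i) (a i) ∧ Kerr.rMinus (M i) (a i) < rin i ∧ rin i < Kerr.rPlus (M i) (a i)) ∧ (∀ i t, |((Λ i t : E4 ≃L[ℝ] E4) (E4.basisVector 0)) 0| ≤ γ) ∧ (∀ i, ContDiff ℝ ((⊤ : ℕ∞) : WithTop ℕ∞) (ξ i) ∧ ContDiff ℝ ((⊤ : ℕ∞) : WithTop ℕ∞) (fun t ↦ ((Λ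 i t : E4 ≃L[ℝ] E4) : E4 →L[ℝ] E4))) ∧ (∀ i j, i ≠ j → Tendsto (fun t ↦ ‖ξ i t - ξ j t‖) atTop atTop) ∧ (0 < κ ∧ κ < 1 ∧ ∀ i, ∀ᶠ t in atTop, ‖ξ i t‖ ≤ κ ^ 2 * t) ∧ ({x : E4 | τ₀ < x 0 ∧ ∀ i, rin i < Kerr.radius (a i) (poincareInv (Λ i (x 0)) (E4.ofTimeSpace (x 0) (ξ i (x 0))) x)} ⊆ (U : Set E4)) ∧ let B : ModelBackground := ⟨U, fun x ↦ Minkowski.bilin + ∑ i, (boostedKerrBilin (Λ i (x 0)) (E4.ofTimeSpace (x 0) (ξ i (x 0))) (M i) (a i) x - Minkowski.bilin), fun x ↦ x 0, E4.spatialNorm⟩; ContMDiff 𝓘(ℝ, E4) (𝓡 4) ((⊤ : ℕ∞) : WithTop ℕ∞) Φ ∧ Topology.IsOpenEmbedding ((B.lateRegion τ₀).restrict Φ) ∧ Φ '' {x : U | τ₀ < x.1 0 ∧ ∀ i, Kerr.rPlus (M i) (a i) < Kerr.radius (a i) (poincareInv (Λ i (x.1 0)) (E4.ofTimeSpace (x.1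 0) (ξ i (x.1 0))) x.1)} ⊆ O ∧ Tendsto (fun t ↦ 𝒟.toSpacetime.deviationCk B Φ 3 t) atTop (𝓝 0) ∧ Tendsto (fun t : ℝ ↦ ⨆ x ∈ {x : U | x.1 0 = t ∧ E4.spatialNorm x.1 ≤ κ * t}, ⨆ (m : ℕ) (_ : m ≤ 3), ENNReal.ofReal (1 + √(√((⨅ i, ‖E4.spatial x.1 - ξ i t‖) ^ 7))) * ‖iteratedFDeriv ℝ m (𝒟.toSpacetime.deviationExtend B Φ) x.1‖ₑ) atTop (𝓝 0) ∧ O = Summit.FinalStateConjecture.exteriorOf 𝒟.toCauchyDevelopment (Φ '' {x : U | τ₀ < x.1 0 ∧ ∀ i, Kerr.rPlus (M i) (a i) < Kerr.radius (a i) (poincareInv (Λ i (x.1 0)) (E4.ofTimeSpace (x.1 0) (ξ i (x.1 0))) x.1)}) ∧ ∀ t₁ : ℝ, τ₀ < t₁ → O \ Φ '' {x : U | t₁ < x.1 0 ∧ ∀ i, Kerr.rPlus (M i) (a i) < Kerr.radius (a i) (poincareInv (Λ i (x.1 0)) (E4.ofTimeSpace (x.1 0) (ξ i (x.1 0))) x.1)}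 ⊆ 𝒟.metric.causalPast 𝒟.timeOrientation (Φ '' {x : U | x.1 0 = t₁ ∧ ∀ i, Kerr.rPlus (M i) (a i) < Kerr.radius (a i) (poincareInv (Λ i (x.1 0)) (E4.ofTimeSpace (x.1 0) (ξ i (x.1 0))) x.1)})) :
    ∃ (O : Set 𝒟.carrier) (d : FinalStateDecomposition 𝒟.toSpacetime O 2), (∀ i, Kerr.IsSubextremal (d.mass i) (d.spin i)) ∧ O = Summit.FinalStateConjecture.exteriorOf 𝒟.toCauchyDevelopment d.charted ∧ Summit.FinalStateConjecture.HasExhaustiveCharts d := by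
  obtain ⟨M, a, rin, Λ, ξ, γ, κ, τ₀, U, Φ, O, -, -, -, -, -, hU, hB⟩ := h
  obtain ⟨hΦ, hemb, himO, hdev, -, hO, hexh⟩ := hB
  simp only [IsEmpty.forall_iff, and_true] at hU himO hO hexh
  -- the Minkowski background on `U` and the Spacetime
  have hb : (fun x : E4 ↦ Minkowski.bilin + ∑ i : Fin 0, (boostedKerrBilin (Λ i (x 0))
      (E4.ofTimeSpace (x 0) (ξ i (x 0))) (M i) (a i) x - Minkowski.bilin)) =
      fun _ ↦ Minkowski.bilin := by
    funext x
    rw [Fin.sum_univ_zero]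
    abel
  have hdev' : Tendsto (fun t ↦ 𝒟.toSpacetime.deviationCk (Minkowski.backgroundOn U) Φ 3 t)
      atTop (𝓝 0) :=
    hdev.congr fun t ↦ deviationCk_mk_congr _ U hb _ _ Φ 3 t
  have hdev2 : Tendsto (fun t ↦ 𝒟.toSpacetime.deviationCk (Minkowski.backgroundOn U) Φ 2 t)
      atTop (𝓝 0) :=
    tendsto_of_tendsto_of_tendsto_of_le_of_le tendsto_const_nhds hdev' (fun _ ↦ zero_le)
      fun t ↦ 𝒟.toSpacetime.deviationCk_mono (Minkowski.backgroundOn U) Φ (by norm_num) t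
  -- the late regions `{x⁰ > τ₀}` ⊇ `{x⁰ > τ₀ + 1}` of the flat background on `U`
  have hsub : (Minkowski.backgroundOn U).lateRegion (τ₀ + 1) ⊆
      (Minkowski.backgroundOn U).lateRegion τ₀ :=
    (Minkowski.backgroundOn U).lateRegion_mono (by linarith)
  have hsub' : (Minkowski.backgroundOn U).lateRegion (τ₀ + 1) ⊆ {x : U | τ₀ < x.1 0} := hsub
  -- open embedding on the smaller late region
  have hemb' : Topology.IsOpenEmbedding
      (((Minkowski.backgroundOn U).lateRegion (τ₀ + 1)).restrict Φ) := by
    have hc0 : Continuous fun y : E4 ↦ y 0 := PiLp.continuous_apply 2 _ 0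
    have hL0 : IsOpen ((Minkowski.backgroundOn U).lateRegion τ₀) :=
      isOpen_lt continuous_const (hc0.comp continuous_subtype_val)
    have hL1 : IsOpen ((Minkowski.backgroundOn U).lateRegion (τ₀ + 1)) :=
      isOpen_lt continuous_const (hc0.comp continuous_subtype_val)
    let j : (Minkowski.backgroundOn U).lateRegion (τ₀ + 1) →
        (Minkowski.backgroundOn U).lateRegion τ₀ := fun x ↦ ⟨x.1, hsub x.2⟩
    have hg0 : Topology.IsOpenEmbedding
        (fun x : (Minkowski.backgroundOn U).lateRegion τ₀ ↦ (x.1.1 : E4)) :=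
      U.isOpen.isOpenEmbedding_subtypeVal.comp hL0.isOpenEmbedding_subtypeVal
    have hg1 : Topology.IsOpenEmbedding
        (fun x : (Minkowski.backgroundOn U).lateRegion (τ₀ + 1) ↦ (x.1.1 : E4)) :=
      U.isOpen.isOpenEmbedding_subtypeVal.comp hL1.isOpenEmbedding_subtypeVal
    have hj : Topology.IsOpenEmbedding j := Topology.IsOpenEmbedding.of_comp j hg0 hg1
    exact hemb.comp hj
  -- its image is open, hence inside its own chronological past
  have hopen : IsOpen (Φ '' (Minkowski.backgroundOn U).lateRegion (τ₀ + 1)) := by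
    rw [← Set.range_restrict]
    exact hemb'.isOpen_range
  -- the hypothesis' region lies to the future of the data
  have hOJ : O ⊆ 𝒟.metric.causalFuture 𝒟.timeOrientation (range 𝒟.embed) := by
    rw [hO]
    exact inter_subset_left
  -- the new region
  let O' : Set 𝒟.carrier := Summit.FinalStateConjecture.exteriorOf 𝒟.toCauchyDevelopment
    (Φ '' (Minkowski.backgroundOn U).lateRegion (τ₀ + 1))
  have hO'O : O' ⊆ O := by
    rw [hO]
    exact inter_subset_inter_right _
      (LorentzianMetric.chronologicalFuture_mono (image_mono hsub'))
  have himO' : Φ '' (Minkowski.backgroundOn U).lateRegion (τ₀ + 1) ⊆ O' :=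
    subset_inter (((image_mono hsub').trans himO).trans hOJ)
      (subset_chronologicalPast_of_isOpen 𝒟.metric 𝒟.timeOrientation hopen)
  -- the decomposition with no hole
  let d : FinalStateDecomposition 𝒟.toSpacetime O' 2 :=
    { N := 0
      mass := Fin.elim0
      spin := Fin.elim0
      mass_pos := fun i ↦ i.elim0
      abs_spin_le_mass := fun i ↦ i.elim0
      motion := Fin.elim0
      τ₀ := τ₀ + 1
      chart := fun i ↦ i.elim0
      isLateChart := fun i ↦ i.elim0
      tendsto_truncDeviationCk := fun i ↦ i.elim0
      exists_pairwise_disjoint := fun _ ↦ ⟨0, fun i ↦ i.elim0⟩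
      excision := Fin.elim0
      tendsto_excision_div := fun i ↦ i.elim0
      flatDomain := U
      setOf_lt_excision_subset_flatDomain := fun x hx ↦
        hU (show τ₀ < x 0 by have hx1 : τ₀ + 1 < x 0 := hx.1; linarith)
      flatChart := Φ
      isLateChart_flat := ⟨hΦ, hemb', himO'⟩
      tendsto_deviationCk_flat := hdev2
      diff_subset_causalPast := by
        intro p hp
        have hp2 : p ∉ Φ '' {x : U | τ₀ + 1 < x.1 0} := fun h' ↦ hp.2 (Or.inr h')
        have hJ := hexh (τ₀ + 1) (by linarith) ⟨hO'O hp.1, hp2⟩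
        exact LorentzianMetric.causalFuture_mono subset_union_right hJ }
  refine ⟨O', d, fun i ↦ i.elim0, ?_, ⟨fun i ↦ i.elim0, fun i ↦ i.elim0, fun i ↦ i.elim0, fun τ₁ hτ₁ ↦ ?_⟩⟩
  · -- `O' = J⁺(ι X) ∩ I⁻(d.charted)`
    have hch : d.charted = Φ '' (Minkowski.backgroundOn U).lateRegion (τ₀ + 1) := by
      ext p
      simp only [FinalStateDecomposition.charted, Set.mem_union, Set.mem_iUnion]
      constructor
      · rintro (h' | ⟨i, -⟩)
        · exact h'
        · exact i.elim0
      · exact fun h' ↦ Or.inl h'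
    rw [hch]
  · -- exhaustion at chart time `τ₁ > τ₀ + 1`
    intro p hp
    have hτ : τ₀ < τ₁ := by
      have hτ' : τ₀ + 1 < τ₁ := hτ₁
      linarith
    have hp2 : p ∉ Φ '' {x : U | τ₁ < x.1 0} := fun h' ↦ hp.2 (Or.inl h')
    have hJ := hexh τ₁ hτ ⟨hO'O hp.1, hp2⟩
    exact LorentzianMetric.causalFuture_mono subset_union_left hJ

/-- Registered one-line form (carrier `deviationCk_mk_congr_rechart11` of the crux item) of
`deviationCk_mk_congr`. [folklore] -/
theorem deviationCk_mk_congr_rechart11 : open Literature.Geometry.Lorentzian in ∀ (𝓢 : Spacetime 4) (U : TopologicalSpace.Opens E4) {b b' : E4 → E4 →L[ℝ] E4 →L[ℝ] ℝ}, b = b' → ∀ (tf rf : E4 → ℝ) (Ψ : U → 𝓢.carrier) (k : ℕ) (τ : ℝ), 𝓢.deviationCk ⟨U, b, tf, rf⟩ Ψ k τ = 𝓢.deviationCk ⟨U, b', tf, rf⟩ Ψ k τ :=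
  fun 𝓢 U _ _ hb tf rf Ψ k τ ↦ deviationCk_mk_congr 𝓢 U hb tf rf Ψ k τ

end Summit.FinalStateConjecture.FinalStateConjecture.Theorems

end
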